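import Literature.Computability.Cryptography.LWERegevMachineSpec
import Literature.Computability.Cryptography.LWESampleCodes
import Literature.Computability.Complexity.SelectBricks
import HarnessLib

/-!
# The oracle machine of Regev's decision-to-search reduction, I: accessors, parameters, query index

Topic `Computability/Cryptography` (LWE), grouping namespace `LWE.RegevBricks`. First of the
files constructing a `RegevMachine c c'` (`LWERegevMachineSpec.lean`: the `FP` query generator
`Q` and output map `G` of `regev_decision_to_search`, `LWEHardness.lean`) in the algebra of `FP`
string functions (`Complexity/BrickAlgebra.lean`, `FoldBricks.lean`, `SelectBricks.lean`, …).
The raw input of both maps is a record `w = ⟨⟨x, r⟩, extra⟩` with `x = encodeLWESamples S'`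
(`= ⟨bin n, ⟨bin q, ⟨1^{m'}, lweBlockCode S'⟩⟩⟩`, `LWESampleCodes.encodeLWESamples_eq`), `r` the coins and
`extra` the unary query number `1^ι` (for `Q`) or the code of the answers (for `G`). This file
provides, as total `FP` string functions of `w` with their values on well-formed `w`:

* accessors `sampW`, `rW`, `exW`, `bnW`, `bqW`, `umW`, `inBlkW`;
* the parameters `bTW = bin T` (`T = Tpar c c' n`), `bEW = bin (nq+1)`, `bNW = bin N`
  (`N = Npar c c' n q`), `bTENW`, `bmW = bin m` (`m = m'/(T(nq+1)N)`), and the unary rulers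
  `onesNW = 1ⁿ`, `onesMW = 1ᵐ` (capped binary-to-unary, exact once `n, m ≤ |w|`);
* the decoding of the query number `ι = rep + N (e# + (nq+1) j)` (`qIdxEquiv`): `bιW`, `brepW`,
  `bjW`, `beW` (the estimate number `e#`), `isGW = [e# = 0]`, and for `e = some (i, k)`
  (`e# = k.val + q i + 1`, `estEquiv`): `bkW = bin k.val`, `biW = bin i`.

## References

* O. Regev, *On lattices, learning with errors, random linear codes, and cryptography*, J. ACM 56
  (2009), art. 34, §4, Lemmas 4.1–4.2. [cite: RegevLWE2009, §4 Lemma 4.1–4.2]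
* S. Arora, B. Barak, *Computational Complexity: A Modern Approach*, CUP 2009, §1.3.
  [cite: AroraBarak2009, §1.3]
-/

noncomputable section

namespace Literature.Computability.Cryptography

namespace LWE

namespace RegevBricks

open _root_.Computability Polynomial Literature.Computability.Complexity Brick Plumb HashBricks RegevReduction

/-! ### Accessors -/

/-- The sample code `x` of `w = ⟨⟨x, r⟩, extra⟩`. [folklore] -/
def sampW : List Bool → List Bool := fstF ∘ fstF
/-- The coins `r`. [folklore] -/
def rW : List Bool → List Bool := sndF ∘ fstF
/-- The extra field (query number / answers). [folklore] -/
def exW : List Bool → List Bool := sndF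
/-- `bin n`. [folklore] -/
def bnW : List Bool → List Bool := nthF 0 ∘ sampW
/-- `bin q`. [folklore] -/
def bqW : List Bool → List Bool := nthF 1 ∘ sampW
/-- `1^{m'}`. [folklore] -/
def umW : List Bool → List Bool := nthF 2 ∘ sampW
/-- The framed sample codes. [folklore] -/
def inBlkW : List Bool → List Bool := sndPow 2 ∘ sampW

/-- `sampW ∈ FP`. [folklore] -/
theorem xW_mem_FP : sampW ∈ FP := comp_mem_FP fstF_mem_FP fstF_mem_FP
/-- `rW ∈ FP`. [folklore] -/
theorem rW_mem_FP : rW ∈ FP := comp_mem_FP sndF_mem_FP fstF_mem_FP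
/-- `exW ∈ FP`. [folklore] -/
theorem exW_mem_FP : exW ∈ FP := sndF_mem_FP
/-- `bnW ∈ FP`. [folklore] -/
theorem bnW_mem_FP : bnW ∈ FP := comp_mem_FP (nthF_mem_FP 0) xW_mem_FP
/-- `bqW ∈ FP`. [folklore] -/
theorem bqW_mem_FP : bqW ∈ FP := comp_mem_FP (nthF_mem_FP 1) xW_mem_FP
/-- `umW ∈ FP`. [folklore] -/
theorem umW_mem_FP : umW ∈ FP := comp_mem_FP (nthF_mem_FP 2) xW_mem_FP
/-- `inBlkW ∈ FP`. [folklore] -/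
theorem bodyW_mem_FP : inBlkW ∈ FP := comp_mem_FP (sndPow_mem_FP 2) xW_mem_FP

section Values

variable {n q M : ℕ} (S : Fin M → (Fin n → ZMod q) × ZMod q) (r ex : List Bool)

/-- Value of `sampW`. [folklore] -/
@[simp] theorem xW_apply : sampW (boolPair (boolPair (encodeLWESamples S) r) ex) = encodeLWESamples S := by simp [sampW]
/-- Value of `rW`. [folklore] -/
@[simp] theorem rW_apply : rW (boolPair (boolPair (encodeLWESamples S) r) ex) = r := by simp [rW]
/-- Value of `exW`. [folklore] -/
@[simp] theorem exW_apply : exW (boolPair (boolPair (encodeLWESamples S) r) ex) = ex := by simp [exW]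
/-- Value of `bnW`. [folklore] -/
@[simp] theorem bnW_apply : bnW (boolPair (boolPair (encodeLWESamples S) r) ex) = encodeNat n := by
  simp [bnW, sampW, encodeLWESamples_eq]
/-- Value of `bqW`. [folklore] -/
@[simp] theorem bqW_apply : bqW (boolPair (boolPair (encodeLWESamples S) r) ex) = encodeNat q := by
  simp [bqW, sampW, encodeLWESamples_eq]
/-- Value of `umW`. [folklore] -/
@[simp] theorem umW_apply : umW (boolPair (boolPair (encodeLWESamples S) r) ex) = ones M := by
  simp [umW, sampW, encodeLWESamples_eq]
/-- Value of `inBlkW`: the block code `lweBlockCode S` (`LWESampleCodes.lean`). [folklore] -/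
@[simp] theorem bodyW_apply : inBlkW (boolPair (boolPair (encodeLWESamples S) r) ex) = lweBlockCode S := by
  simp [inBlkW, sampW, encodeLWESamples_eq]

end Values

/-! ### Parameters -/

section Params

variable (c c' : ℕ)

/-- `bin T`, `T = n^{c+c'+1}`. [cite: RegevLWE2009, §4 Lemma 4.1 (proof)] -/
def bTW : List Bool → List Bool := natPowFn (c + c' + 1) ∘ bnW
/-- `bin (nq + 1)` (the number of estimates). [folklore] -/
def bEW : List Bool → List Bool := addFn ∘ fanoutFn (prodFn ∘ fanoutFn bnW bqW) (fun _ => [true])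
/-- `bin N`, `N = n^{3c+2c'+3} q`. [cite: RegevLWE2009, §4 Lemma 4.1 (proof)] -/
def bNW : List Bool → List Bool := prodFn ∘ fanoutFn (natPowFn (3 * c + 2 * c' + 3) ∘ bnW) bqW
/-- `bin (T (nq+1) N)` (the number of blocks). [folklore] -/
def bTENW : List Bool → List Bool := prodFn ∘ fanoutFn (prodFn ∘ fanoutFn (bTW c c') bEW) (bNW c c')
/-- `bin m`, `m = m' / (T (nq+1) N)`. [folklore] -/
def bmW : List Bool → List Bool := divFn ∘ fanoutFn (lenBinF ∘ umW) (bTENW c c')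
/-- The ruler `1ⁿ` (capped at `|w|`). [folklore] -/
def onesNW : List Bool → List Bool := binToUnaryFn ∘ fanoutFn (fun w => w) bnW
/-- The ruler `1ᵐ` (capped at `|w|`). [folklore] -/
def onesMW : List Bool → List Bool := binToUnaryFn ∘ fanoutFn (fun w => w) (bmW c c')

/-- `bTW ∈ FP`. [folklore] -/
theorem bTW_mem_FP : bTW c c' ∈ FP := comp_mem_FP (natPowFn_mem_FP _) bnW_mem_FP
/-- `bEW ∈ FP`. [folklore] -/
theorem bEW_mem_FP : bEW ∈ FP :=
  comp_mem_FP addFn_mem_FP (fanoutFn_mem_FP (comp_mem_FP prodFn_mem_FP (fanoutFn_mem_FP bnW_mem_FP bqW_mem_FP))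
    (const_mem_FP _))
/-- `bNW ∈ FP`. [folklore] -/
theorem bNW_mem_FP : bNW c c' ∈ FP :=
  comp_mem_FP prodFn_mem_FP (fanoutFn_mem_FP (comp_mem_FP (natPowFn_mem_FP _) bnW_mem_FP) bqW_mem_FP)
/-- `bTENW ∈ FP`. [folklore] -/
theorem bTENW_mem_FP : bTENW c c' ∈ FP :=
  comp_mem_FP prodFn_mem_FP (fanoutFn_mem_FP (comp_mem_FP prodFn_mem_FP (fanoutFn_mem_FP (bTW_mem_FP c c') bEW_mem_FP))
    (bNW_mem_FP c c'))
/-- `bmW ∈ FP`. [folklore] -/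
theorem bmW_mem_FP : bmW c c' ∈ FP :=
  comp_mem_FP divFn_mem_FP (fanoutFn_mem_FP (comp_mem_FP lenBinF_mem_FP umW_mem_FP) (bTENW_mem_FP c c'))
/-- `onesNW ∈ FP`. [folklore] -/
theorem onesNW_mem_FP : onesNW ∈ FP :=
  comp_mem_FP binToUnaryFn_mem_FP (fanoutFn_mem_FP OracleCompose.id_mem_FP bnW_mem_FP)
/-- `onesMW ∈ FP`. [folklore] -/
theorem onesMW_mem_FP : onesMW c c' ∈ FP :=
  comp_mem_FP binToUnaryFn_mem_FP (fanoutFn_mem_FP OracleCompose.id_mem_FP (bmW_mem_FP c c'))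

variable {c c'}
variable {n q m : ℕ} (S' : Fin (Tpar c c' n * (n * q + 1) * Npar c c' n q * m) → (Fin n → ZMod q) × ZMod q)
  (r ex : List Bool)

/-- Value of `bTW`. [folklore] -/
@[simp] theorem bTW_apply : bTW c c' (boolPair (boolPair (encodeLWESamples S') r) ex) = encodeNat (Tpar c c' n) := by
  simp [bTW, Tpar]
/-- Value of `bEW`. [folklore] -/
@[simp] theorem bEW_apply : bEW (boolPair (boolPair (encodeLWESamples S') r) ex) = encodeNat (n * q + 1) := by
  simp [bEW]
/-- Value of `bNW`. [folklore] -/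
@[simp] theorem bNW_apply : bNW c c' (boolPair (boolPair (encodeLWESamples S') r) ex) = encodeNat (Npar c c' n q) := by
  simp [bNW, Npar]
/-- Value of `bTENW`. [folklore] -/
@[simp] theorem bTENW_apply : bTENW c c' (boolPair (boolPair (encodeLWESamples S') r) ex) =
    encodeNat (Tpar c c' n * (n * q + 1) * Npar c c' n q) := by
  simp [bTENW]
/-- Value of `bmW` (`n, q ≥ 1`). [folklore] -/
theorem bmW_apply (hn : 0 < n) (hq : 0 < q) :
    bmW c c' (boolPair (boolPair (encodeLWESamples S') r) ex) = encodeNat m := by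
  have hpos : 0 < Tpar c c' n * (n * q + 1) * Npar c c' n q :=
    Nat.mul_pos (Nat.mul_pos (Tpar_pos hn) (Nat.succ_pos _)) (Npar_pos hn hq)
  simp [bmW]
  exact congrArg encodeNat (Nat.mul_div_cancel_left m hpos)

/-- Value of `onesNW` once `n ≤ |w|`. [folklore] -/
theorem onesNW_apply (h : n ≤ (boolPair (boolPair (encodeLWESamples S') r) ex).length) :
    onesNW (boolPair (boolPair (encodeLWESamples S') r) ex) = ones n := by
  simp only [onesNW, Function.comp_apply, fanoutFn_apply, bnW_apply, binToUnaryFn_boolPair, bitsToNat_encodeNat,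
    min_eq_left h]

/-- Value of `onesMW` once `m ≤ |w|` (`n, q ≥ 1`). [folklore] -/
theorem onesMW_apply (hn : 0 < n) (hq : 0 < q) (h : m ≤ (boolPair (boolPair (encodeLWESamples S') r) ex).length) :
    onesMW c c' (boolPair (boolPair (encodeLWESamples S') r) ex) = ones m := by
  simp only [onesMW, Function.comp_apply, fanoutFn_apply, bmW_apply S' r ex hn hq, binToUnaryFn_boolPair,
    bitsToNat_encodeNat, min_eq_left h]

end Params

/-! ### Decoding the query number -/

section Index

variable (c c' : ℕ)

/-- `bin ι` from the unary query number `1^ι`. [folklore] -/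
def bιW : List Bool → List Bool := lenBinF ∘ exW
/-- `bin rep = bin (ι mod N)`. [folklore] -/
def brepW : List Bool → List Bool := remFn ∘ fanoutFn bιW (bNW c c')
/-- `bin (ι / N) = bin (e# + (nq+1) j)`. [folklore] -/
def bx1W : List Bool → List Bool := divFn ∘ fanoutFn bιW (bNW c c')
/-- `bin e#` (the estimate number). [folklore] -/
def beW : List Bool → List Bool := remFn ∘ fanoutFn (bx1W c c') bEW
/-- `bin j` (the round). [folklore] -/
def bjW : List Bool → List Bool := divFn ∘ fanoutFn (bx1W c c') bEW
/-- The bit `[e# = 0]`: is the estimate the plain shifted one? [folklore] -/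
def isGW : List Bool → List Bool := isNilFn ∘ beW c c'
/-- `bin (e# - 1) = bin (k.val + q i)` for a coordinate test. [folklore] -/
def be1W : List Bool → List Bool := subFn ∘ fanoutFn (beW c c') (fun _ => [true])
/-- `bin k.val` (the guess) for a coordinate test. [folklore] -/
def bkW : List Bool → List Bool := remFn ∘ fanoutFn (be1W c c') bqW
/-- `bin i` (the tested coordinate) for a coordinate test. [folklore] -/
def biW : List Bool → List Bool := divFn ∘ fanoutFn (be1W c c') bqW

/-- `bιW ∈ FP`. [folklore] -/
theorem bιW_mem_FP : bιW ∈ FP := comp_mem_FP lenBinF_mem_FP exW_mem_FP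
/-- `brepW ∈ FP`. [folklore] -/
theorem brepW_mem_FP : brepW c c' ∈ FP := comp_mem_FP remFn_mem_FP (fanoutFn_mem_FP bιW_mem_FP (bNW_mem_FP c c'))
/-- `bx1W ∈ FP`. [folklore] -/
theorem bx1W_mem_FP : bx1W c c' ∈ FP := comp_mem_FP divFn_mem_FP (fanoutFn_mem_FP bιW_mem_FP (bNW_mem_FP c c'))
/-- `beW ∈ FP`. [folklore] -/
theorem beW_mem_FP : beW c c' ∈ FP := comp_mem_FP remFn_mem_FP (fanoutFn_mem_FP (bx1W_mem_FP c c') bEW_mem_FP)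
/-- `bjW ∈ FP`. [folklore] -/
theorem bjW_mem_FP : bjW c c' ∈ FP := comp_mem_FP divFn_mem_FP (fanoutFn_mem_FP (bx1W_mem_FP c c') bEW_mem_FP)
/-- `isGW ∈ FP`. [folklore] -/
theorem isGW_mem_FP : isGW c c' ∈ FP := comp_mem_FP isNilFn_mem_FP (beW_mem_FP c c')
/-- `be1W ∈ FP`. [folklore] -/
theorem be1W_mem_FP : be1W c c' ∈ FP := comp_mem_FP subFn_mem_FP (fanoutFn_mem_FP (beW_mem_FP c c') (const_mem_FP _))
/-- `bkW ∈ FP`. [folklore] -/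
theorem bkW_mem_FP : bkW c c' ∈ FP := comp_mem_FP remFn_mem_FP (fanoutFn_mem_FP (be1W_mem_FP c c') bqW_mem_FP)
/-- `biW ∈ FP`. [folklore] -/
theorem biW_mem_FP : biW c c' ∈ FP := comp_mem_FP divFn_mem_FP (fanoutFn_mem_FP (be1W_mem_FP c c') bqW_mem_FP)

/-- `isGW` is one-bit. [folklore] -/
theorem oneBit_isGW : OneBit (isGW c c') := oneBit_isNilFn.comp _

variable {c c'}
variable {n q m : ℕ} [NeZero q] (S' : Fin (Tpar c c' n * (n * q + 1) * Npar c c' n q * m) → (Fin n → ZMod q) × ZMod q)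
  (r : List Bool) (j : Fin (Tpar c c' n)) (e : Est n q) (rep : Fin (Npar c c' n q))

/-- The query number of `(j, e, rep)`, spelled out. [folklore] -/
theorem qIdx_val_eq : (qIdxEquiv n q (Npar c c' n q) (Tpar c c' n) (j, e, rep)).val =
    rep + Npar c c' n q * ((estEquiv n q e).val + (n * q + 1) * j) :=
  qIdxEquiv_apply_val j e rep

omit [NeZero q] in
/-- Value of `bιW`. [folklore] -/
@[simp] theorem bιW_apply (ι : ℕ) : bιW (boolPair (boolPair (encodeLWESamples S') r) (ones ι)) = encodeNat ι := by
  simp [bιW, ones]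

/-- Value of `brepW`: the repetition index. [folklore] -/
theorem brepW_apply : brepW c c' (boolPair (boolPair (encodeLWESamples S') r)
      (ones (qIdxEquiv n q (Npar c c' n q) (Tpar c c' n) (j, e, rep)).val)) = encodeNat rep := by
  simp only [brepW, Function.comp_apply, fanoutFn_apply, bιW_apply, bNW_apply, remFn_boolPair, bitsToNat_encodeNat,
    qIdx_val_eq, Nat.add_mul_mod_self_left, Nat.mod_eq_of_lt rep.isLt]

/-- Value of `bx1W`. [folklore] -/
theorem bx1W_apply (hN : 0 < Npar c c' n q) : bx1W c c' (boolPair (boolPair (encodeLWESamples S') r)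
      (ones (qIdxEquiv n q (Npar c c' n q) (Tpar c c' n) (j, e, rep)).val)) =
    encodeNat ((estEquiv n q e).val + (n * q + 1) * j) := by
  simp only [bx1W, Function.comp_apply, fanoutFn_apply, bιW_apply, bNW_apply, divFn_boolPair, bitsToNat_encodeNat,
    qIdx_val_eq, Nat.add_mul_div_left _ _ hN, Nat.div_eq_of_lt rep.isLt, zero_add]

/-- Value of `beW`: the estimate number. [folklore] -/
theorem beW_apply (hN : 0 < Npar c c' n q) : beW c c' (boolPair (boolPair (encodeLWESamples S') r)
      (ones (qIdxEquiv n q (Npar c c' n q) (Tpar c c' n) (j, e, rep)).val)) = encodeNat (estEquiv n q e).val := by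
  simp only [beW, Function.comp_apply, fanoutFn_apply, bx1W_apply S' r j e rep hN, bEW_apply, remFn_boolPair,
    bitsToNat_encodeNat, Nat.add_mul_mod_self_left, Nat.mod_eq_of_lt (estEquiv n q e).isLt]

/-- Value of `bjW`: the round. [folklore] -/
theorem bjW_apply (hN : 0 < Npar c c' n q) : bjW c c' (boolPair (boolPair (encodeLWESamples S') r)
      (ones (qIdxEquiv n q (Npar c c' n q) (Tpar c c' n) (j, e, rep)).val)) = encodeNat j := by
  simp only [bjW, Function.comp_apply, fanoutFn_apply, bx1W_apply S' r j e rep hN, bEW_apply, divFn_boolPair,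
    bitsToNat_encodeNat, Nat.add_mul_div_left _ _ (Nat.succ_pos _), Nat.div_eq_of_lt (estEquiv n q e).isLt, zero_add]

/-- The estimate number is `0` iff the estimate is the plain shifted one. [folklore] -/
theorem estEquiv_val_eq_zero_iff (e : Est n q) : (estEquiv n q e).val = 0 ↔ e = none := by
  cases e with
  | none => simp
  | some ik => obtain ⟨i, k⟩ := ik; simp

/-- Value of `isGW`: `[e = none]`. [folklore] -/
theorem isGW_apply (hN : 0 < Npar c c' n q) : isGW c c' (boolPair (boolPair (encodeLWESamples S') r)
      (ones (qIdxEquiv n q (Npar c c' n q) (Tpar c c' n) (j, e, rep)).val)) = [decide (e = none)] := by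
  simp only [isGW, Function.comp_apply, beW_apply S' r j e rep hN, isNilFn, encodeNat_eq_nil_iff,
    estEquiv_val_eq_zero_iff]

variable (i : Fin n) (k : ZMod q)

/-- Value of `be1W` for a coordinate test. [folklore] -/
theorem be1W_apply (hN : 0 < Npar c c' n q) : be1W c c' (boolPair (boolPair (encodeLWESamples S') r)
      (ones (qIdxEquiv n q (Npar c c' n q) (Tpar c c' n) (j, some (i, k), rep)).val)) = encodeNat (k.val + q * i) := by
  simp only [be1W, Function.comp_apply, fanoutFn_apply, beW_apply S' r j _ rep hN, estEquiv_some_val, subFn_boolPair,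
    bitsToNat_encodeNat]
  rfl

/-- Value of `bkW`: the guess `k.val`. [folklore] -/
theorem bkW_apply (hN : 0 < Npar c c' n q) : bkW c c' (boolPair (boolPair (encodeLWESamples S') r)
      (ones (qIdxEquiv n q (Npar c c' n q) (Tpar c c' n) (j, some (i, k), rep)).val)) = encodeNat k.val := by
  simp only [bkW, Function.comp_apply, fanoutFn_apply, be1W_apply S' r j rep i k hN, bqW_apply, remFn_boolPair,
    bitsToNat_encodeNat, Nat.add_mul_mod_self_left, Nat.mod_eq_of_lt k.val_lt]

/-- Value of `biW`: the tested coordinate `i`. [folklore] -/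
theorem biW_apply (hN : 0 < Npar c c' n q) : biW c c' (boolPair (boolPair (encodeLWESamples S') r)
      (ones (qIdxEquiv n q (Npar c c' n q) (Tpar c c' n) (j, some (i, k), rep)).val)) = encodeNat i := by
  simp only [biW, Function.comp_apply, fanoutFn_apply, be1W_apply S' r j rep i k hN, bqW_apply, divFn_boolPair,
    bitsToNat_encodeNat, Nat.add_mul_div_left _ _ (Nat.pos_of_ne_zero (NeZero.ne q)), Nat.div_eq_of_lt k.val_lt, zero_add]

end Index

/-! ### The well-formed root input and its size -/

section Root

variable {c c' : ℕ} {n q m : ℕ} [NeZero q]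
  (S' : Fin (Tpar c c' n * (n * q + 1) * Npar c c' n q * m) → (Fin n → ZMod q) × ZMod q) (r : List Bool)
  (qi : QIdx n q (Npar c c' n q) (Tpar c c' n))

/-- The root input `w = ⟨⟨encodeLWESamples S', r⟩, 1^ι⟩` of the query generator for query `qi`.
[folklore] -/
def wOf : List Bool :=
  boolPair (boolPair (encodeLWESamples S') r) (ones (qIdxEquiv n q (Npar c c' n q) (Tpar c c' n) qi).val)

/-- `wOf` unfolded. [folklore] -/
theorem wOf_eq : wOf S' r qi =
    boolPair (boolPair (encodeLWESamples S') r) (ones (qIdxEquiv n q (Npar c c' n q) (Tpar c c' n) qi).val) := rfl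

/-- The number of blocks is positive (`n ≥ 1`). [folklore] -/
theorem numQueries_pos (hn : 0 < n) : 0 < Tpar c c' n * (n * q + 1) * Npar c c' n q :=
  Nat.mul_pos (Nat.mul_pos (Tpar_pos hn) (Nat.succ_pos _)) (Npar_pos hn (Nat.pos_of_ne_zero (NeZero.ne q)))

/-- `T n ≤ T (nq+1) N m` (`n, m ≥ 1`). [folklore] -/
theorem Tn_le_numSamples (hn : 0 < n) (hm : 0 < m) :
    Tpar c c' n * n ≤ Tpar c c' n * (n * q + 1) * Npar c c' n q * m := by
  have hNm : 1 ≤ Npar c c' n q * m :=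
    Nat.one_le_iff_ne_zero.2 (Nat.mul_ne_zero (Npar_pos hn (Nat.pos_of_ne_zero (NeZero.ne q))).ne' hm.ne')
  have hq1 : 1 ≤ q := Nat.pos_of_ne_zero (NeZero.ne q)
  have hnq : n ≤ n * q + 1 := (Nat.le_mul_of_pos_right n hq1).trans (Nat.le_succ _)
  have h2 : n ≤ (n * q + 1) * (Npar c c' n q * m) := hnq.trans (Nat.le_mul_of_pos_right _ hNm)
  calc Tpar c c' n * n ≤ Tpar c c' n * ((n * q + 1) * (Npar c c' n q * m)) := Nat.mul_le_mul_left _ h2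
    _ = _ := by ring

omit [NeZero q] in
/-- **Size of a root** `⟨⟨x, r⟩, ex⟩`: `T(nq+1)Nm · (2n + 2) ≤ |x| ≤ |root|`. [folklore] -/
theorem numSamples_mul_le_length_root (ex : List Bool) :
    Tpar c c' n * (n * q + 1) * Npar c c' n q * m * (2 * n + 2) ≤ (boolPair (boolPair (encodeLWESamples S') r) ex).length := by
  refine (mul_le_length_encodeLWESamples S').trans ?_
  rw [length_boolPair, length_boolPair]
  omega

/-- Everything the machine handles in unary fits a root `⟨⟨x, r⟩, ex⟩`: `n, m, q, T, N`, the
number of samples, and the number of coin chunks `T n + T(nq+1)Nm`. [folklore] -/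
theorem bounds_root (ex : List Bool) (hn : 0 < n) (hm : 0 < m) :
    n ≤ (boolPair (boolPair (encodeLWESamples S') r) ex).length ∧
      m ≤ (boolPair (boolPair (encodeLWESamples S') r) ex).length ∧
      q ≤ (boolPair (boolPair (encodeLWESamples S') r) ex).length ∧
      Tpar c c' n ≤ (boolPair (boolPair (encodeLWESamples S') r) ex).length ∧
      Npar c c' n q ≤ (boolPair (boolPair (encodeLWESamples S') r) ex).length ∧
      Tpar c c' n * (n * q + 1) * Npar c c' n q * m ≤ (boolPair (boolPair (encodeLWESamples S') r) ex).length ∧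
      Tpar c c' n * n + Tpar c c' n * (n * q + 1) * Npar c c' n q * m ≤
        (boolPair (boolPair (encodeLWESamples S') r) ex).length := by
  have hx := numSamples_mul_le_length_root S' r (c := c) (c' := c') ex
  have hTn := Tn_le_numSamples (c := c) (c' := c') (q := q) hn hm
  have hT : 1 ≤ Tpar c c' n := Tpar_pos hn
  have hq1 : 1 ≤ q := Nat.pos_of_ne_zero (NeZero.ne q)
  have hN : 1 ≤ Npar c c' n q := Npar_pos hn hq1
  have hM1 : 1 ≤ Tpar c c' n * (n * q + 1) * Npar c c' n q * m :=
    hn.trans_le ((Nat.le_mul_of_pos_left n hT).trans hTn)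
  have h2M : 2 * (Tpar c c' n * (n * q + 1) * Npar c c' n q * m) ≤ (boolPair (boolPair (encodeLWESamples S') r) ex).length :=
    le_trans (Nat.mul_le_mul_right _ (by omega) |>.trans (Nat.mul_comm _ _).le) hx
  have hTM : Tpar c c' n ≤ Tpar c c' n * (n * q + 1) * Npar c c' n q * m :=
    (Nat.le_mul_of_pos_right _ hn).trans hTn
  have hE : n * q + 1 ≤ Tpar c c' n * (n * q + 1) * Npar c c' n q * m :=
    calc n * q + 1 = 1 * (n * q + 1) * 1 * 1 := by ring
      _ ≤ Tpar c c' n * (n * q + 1) * Npar c c' n q * m :=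
        Nat.mul_le_mul (Nat.mul_le_mul (Nat.mul_le_mul_right _ hT) hN) hm
  have hNM : Npar c c' n q ≤ Tpar c c' n * (n * q + 1) * Npar c c' n q * m :=
    calc Npar c c' n q = 1 * 1 * Npar c c' n q * 1 := by ring
      _ ≤ Tpar c c' n * (n * q + 1) * Npar c c' n q * m :=
        Nat.mul_le_mul (Nat.mul_le_mul_right _ (Nat.mul_le_mul hT (Nat.succ_pos _))) hm
  have hqE : q ≤ n * q + 1 := (Nat.le_mul_of_pos_left q hn).trans (Nat.le_succ _)
  have hmM : m ≤ Tpar c c' n * (n * q + 1) * Npar c c' n q * m :=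
    Nat.le_mul_of_pos_left m (numQueries_pos (c := c) (c' := c') hn)
  have hnE : n ≤ n * q + 1 := (Nat.le_mul_of_pos_right n hq1).trans (Nat.le_succ _)
  omega

/-- **Size of the root**: `T(nq+1)Nm · (2n + 2) ≤ |x| ≤ |w|`. [folklore] -/
theorem numSamples_mul_le_length_wOf :
    Tpar c c' n * (n * q + 1) * Npar c c' n q * m * (2 * n + 2) ≤ (wOf S' r qi).length :=
  numSamples_mul_le_length_root S' r _

/-- The bounds of `bounds_root` for the query root `wOf`. [folklore] -/
theorem bounds_wOf (hn : 0 < n) (hm : 0 < m) :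
    n ≤ (wOf S' r qi).length ∧ m ≤ (wOf S' r qi).length ∧ q ≤ (wOf S' r qi).length ∧
      Tpar c c' n ≤ (wOf S' r qi).length ∧ Npar c c' n q ≤ (wOf S' r qi).length ∧
      Tpar c c' n * (n * q + 1) * Npar c c' n q * m ≤ (wOf S' r qi).length ∧
      Tpar c c' n * n + Tpar c c' n * (n * q + 1) * Npar c c' n q * m ≤ (wOf S' r qi).length :=
  bounds_root S' r _ hn hm

end Root

end RegevBricks

end LWE

end Literature.Computability.Cryptography

end
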